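import Literature.NumberTheory.Sieve.Maynard2016Lemma7LamShift

/-!
# Maynard (2016), Lemma 7 — the `q`-sum in a residue class modulo a mid prime: main/error split

J. Maynard, *Large gaps between primes*, Ann. of Math. 183 (2016), §6, proof of Lemma 7, the
paragraph before (6.33): for the correction terms of `w_n` one needs the sum
`Σ_{q ∈ 𝓘_m, q ≡ c (mod p)} (Σ_{d,e} λ_{d,e})²` over the primes `q` of the interval in ONE residue
class modulo a mid prime `p` («we may restrict `q` to a residue class; the main term is multiplied
by `≪_k 1/p`»).  This file is the class analogue of `Maynard2016Lemma7ErrorSplit` and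
`Maynard2016Lemma7ProbModel`:

* `sysDP`, `sysPP`, `sysAP` — the system (6.27) extended by the condition `q ≡ c (mod p)`
  (index `Option (Fin k ⊕ Fin k)`, the new index `none` carrying modulus `p`, constant `−c`,
  coefficient `1`); `radP` its radical `rad(p · ∏ [d_j,d'_j][e_j,e'_j])`; `SysSolvableP`,
  `mainCoeffP` as in `Maynard2016Lemma7ErrorSplit`;
* `abs_card_filter_class_system_sub_mainCoeffP_le` — per tuple, `|#{q ∈ 𝓘 : q ≡ c (p), (6.27)} −
  mainCoeffP(#𝓘)| ≤ 2 E*(X; radP)`; summed with the weights: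
  `abs_sum_filter_divSum_sq_sub_main_le`;
* `QformP`, `QformP_mul_totient_eq_sum_filter_unitsR` — the main-term quadratic form is the
  RESTRICTED second moment `Σ_{u ∈ U_R, u ≡ c (p)} X_Λ(u) X_{Λ'}(u)/φ(R)` of the probability model;
* `QformP_le_Qform` (trivial bound) and `QformP_le_sum_Qform_of_pfPart` (the class bound of
  `Maynard2016Lemma7LamShift`: `Q_p(Λ) ≤ (2·4^k/(p−1)) Σ_{S,T} Q(W_{S,T})`).

## References

* J. Maynard, *Large gaps between primes*, Ann. of Math. (2) 183 (2016), 915–933; arXiv:1408.5110,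
  §6, proof of Lemma 7 (before (6.33)), displays (6.27)–(6.29). [Maynard2016LargeGaps]
-/

noncomputable section

open Finset
open scoped BigOperators

namespace Literature.NumberTheory.Sieve

namespace Maynard2016

variable {k : ℕ}

/-! ### The system extended by `q ≡ c (mod p)` -/

/-- Moduli of the extended system: `p` at the new index, `sysD` elsewhere. [cite: Maynard2016LargeGaps, Lemma 7 (proof, before (6.33))] -/
def sysDP (p : ℕ) (d d' e e' : Fin k → ℕ) : Option (Fin k ⊕ Fin k) → ℕ :=
  fun t => t.elim p (sysD d d' e e')

/-- Constant terms of the extended system: `−c` at the new index. [cite: Maynard2016LargeGaps, Lemma 7 (proof, before (6.33))] -/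
def sysPP (c : ℕ) (k m p₀ : ℕ) : Option (Fin k ⊕ Fin k) → ℤ :=
  fun t => t.elim (-(c : ℤ)) (sysP k m p₀)

/-- Coefficients of the extended system: `1` at the new index. [cite: Maynard2016LargeGaps, Lemma 7 (proof, before (6.33))] -/
def sysAP (k x : ℕ) (i : Fin k) (m : ℕ) : Option (Fin k ⊕ Fin k) → ℤ :=
  fun t => t.elim 1 (sysA k x i m)

/-- The new modulus is `p`. [cite: Maynard2016LargeGaps, Lemma 7 (proof, before (6.33))] -/
@[simp] theorem sysDP_none (p : ℕ) (d d' e e' : Fin k → ℕ) : sysDP p d d' e e' none = p := rfl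

/-- The old moduli are those of (6.27). [cite: Maynard2016LargeGaps, Lemma 7 (proof, before (6.33))] -/
@[simp] theorem sysDP_some (p : ℕ) (d d' e e' : Fin k → ℕ) (t : Fin k ⊕ Fin k) :
    sysDP p d d' e e' (some t) = sysD d d' e e' t := rfl

/-- The new constant term is `−c`. [cite: Maynard2016LargeGaps, Lemma 7 (proof, before (6.33))] -/
@[simp] theorem sysPP_none (c k m p₀ : ℕ) : sysPP c k m p₀ none = -(c : ℤ) := rfl

/-- The old constant terms are those of (6.27). [cite: Maynard2016LargeGaps, Lemma 7 (proof, before (6.33))] -/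
@[simp] theorem sysPP_some (c k m p₀ : ℕ) (t : Fin k ⊕ Fin k) :
    sysPP c k m p₀ (some t) = sysP k m p₀ t := rfl

/-- The new coefficient is `1`. [cite: Maynard2016LargeGaps, Lemma 7 (proof, before (6.33))] -/
@[simp] theorem sysAP_none (k x : ℕ) (i : Fin k) (m : ℕ) : sysAP k x i m none = 1 := rfl

/-- The old coefficients are those of (6.27). [cite: Maynard2016LargeGaps, Lemma 7 (proof, before (6.33))] -/
@[simp] theorem sysAP_some (k x : ℕ) (i : Fin k) (m : ℕ) (t : Fin k ⊕ Fin k) :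
    sysAP k x i m (some t) = sysA k x i m t := rfl

/-- `p ∣ −c + 1·q ↔ q % p = c` for `c < p`. [cite: Maynard2016LargeGaps, Lemma 7 (proof, before (6.33))] -/
theorem intDvd_neg_add_iff_mod_eq {p c : ℕ} (hc : c < p) (q : ℕ) :
    (p : ℤ) ∣ -(c : ℤ) + 1 * (q : ℤ) ↔ q % p = c := by
  rw [one_mul, neg_add_eq_sub, ← Nat.modEq_iff_dvd, Nat.ModEq, Nat.mod_eq_of_lt hc]
  exact ⟨fun h => h.symm, fun h => h.symm⟩

/-- The extended system is `q ≡ c (mod p)` together with the system (6.27).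
[cite: Maynard2016LargeGaps, Lemma 7 (proof, before (6.33))] -/
theorem classSystem_iff {p c : ℕ} (hc : c < p) {x m p₀ : ℕ} {i : Fin k} (d d' e e' : Fin k → ℕ)
    (q : ℕ) :
    (∀ t ∈ (Finset.univ : Finset (Option (Fin k ⊕ Fin k))),
        (sysDP p d d' e e' t : ℤ) ∣ sysPP c k m p₀ t + sysAP k x i m t * (q : ℤ)) ↔
      q % p = c ∧ ∀ t ∈ (Finset.univ : Finset (Fin k ⊕ Fin k)),
        (sysD d d' e e' t : ℤ) ∣ sysP k m p₀ t + sysA k x i m t * (q : ℤ) := by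
  simp only [Finset.mem_univ, true_implies, Option.forall, sysDP_none, sysPP_none, sysAP_none,
    sysDP_some, sysPP_some, sysAP_some, intDvd_neg_add_iff_mod_eq hc]

/-- The product of the extended moduli. [cite: Maynard2016LargeGaps, Lemma 7 (proof, before (6.33))] -/
theorem prod_sysDP (p : ℕ) (d d' e e' : Fin k → ℕ) :
    ∏ t, sysDP p d d' e e' t = p * ∏ t, sysD d d' e e' t := by
  rw [Fintype.prod_option]
  rfl

/-- `r_p = rad(p · ∏_t sysD_t)`, the modulus of the single class of `q` for the extended system.
[cite: Maynard2016LargeGaps, Lemma 7 (proof, display (6.28) and before (6.33))] -/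
def radP (p : ℕ) (d d' e e' : Fin k → ℕ) : ℕ := ∏ q ∈ (p * ∏ t, sysD d d' e e' t).primeFactors, q

/-- `r_p > 0`. [cite: Maynard2016LargeGaps, Lemma 7 (proof, display (6.28))] -/
theorem radP_pos (p : ℕ) (d d' e e' : Fin k → ℕ) : 0 < radP p d d' e e' :=
  Finset.prod_pos fun _ hq => (Nat.prime_of_mem_primeFactors hq).pos

/-- The radical of the extended system is `r_p`. [cite: Maynard2016LargeGaps, Lemma 7 (proof, display (6.28))] -/
theorem rad_sysDP_eq (p : ℕ) (d d' e e' : Fin k → ℕ) :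
    ∏ q ∈ (∏ t ∈ (Finset.univ : Finset (Option (Fin k ⊕ Fin k))), sysDP p d d' e e' t).primeFactors,
      q = radP p d d' e e' := by
  rw [radP, prod_sysDP]

/-- Solvability of the extended system in `q ∈ ℕ`. [cite: Maynard2016LargeGaps, Lemma 7 (proof, before (6.33))] -/
def SysSolvableP (p c : ℕ) (k x m p₀ : ℕ) (i : Fin k) (d d' e e' : Fin k → ℕ) : Prop :=
  ∃ q : ℕ, q % p = c ∧ ∀ t ∈ (Finset.univ : Finset (Fin k ⊕ Fin k)),
    (sysD d d' e e' t : ℤ) ∣ sysP k m p₀ t + sysA k x i m t * (q : ℤ)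

open Classical in
/-- The main coefficient of a tuple for the class sum: `N/φ(r_p)` if the extended system is solvable,
`0` otherwise. [cite: Maynard2016LargeGaps, Lemma 7 (proof, display (6.29) and before (6.33))] -/
def mainCoeffP (p c : ℕ) (k x m p₀ : ℕ) (i : Fin k) (d d' e e' : Fin k → ℕ) (N : ℝ) : ℝ :=
  if SysSolvableP p c k x m p₀ i d d' e e' then N / (Nat.totient (radP p d d' e e') : ℝ) else 0

/-- `mainCoeffP N = N · mainCoeffP 1`. [cite: Maynard2016LargeGaps, Lemma 7 (proof, display (6.29))] -/
theorem mainCoeffP_eq_mul_one (p c k x m p₀ : ℕ) (i : Fin k) (d d' e e' : Fin k → ℕ) (N : ℝ) :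
    mainCoeffP p c k x m p₀ i d d' e e' N = N * mainCoeffP p c k x m p₀ i d d' e e' 1 := by
  classical
  unfold mainCoeffP
  split_ifs <;> ring

/-! ### Hypotheses of the class dichotomy for the extended system -/

/-- The extended moduli are squarefree. [cite: Maynard2016LargeGaps, Lemma 7 (proof, p. 12)] -/
theorem sysP_squarefree {p : ℕ} (hp : p.Prime) {d d' e e' : Fin k → ℕ} (hd : ∀ j, Squarefree (d j))
    (hd' : ∀ j, Squarefree (d' j)) (he : ∀ j, Squarefree (e j)) (he' : ∀ j, Squarefree (e' j)) :
    ∀ t ∈ (Finset.univ : Finset (Option (Fin k ⊕ Fin k))), Squarefree (sysDP p d d' e e' t) := by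
  rintro (_ | t) -
  · exact hp.squarefree
  · exact sys_squarefree hd hd' he he' t (Finset.mem_univ t)

/-- The extended coefficients are units. [cite: Maynard2016LargeGaps, Lemma 7 (proof, p. 12)] -/
theorem sysP_unit {p : ℕ} {x m p₀ : ℕ} (hp₀ : p₀.Prime) {i : Fin k} {d d' e e' : Fin k → ℕ}
    (hd0 : ∀ j, d j ≠ 0) (hd0' : ∀ j, d' j ≠ 0) (hdlt : ∀ j, d j * d' j < p₀)
    (hei : e i = 1) (hei' : e' i = 1)
    (hacop : ∀ j, j ≠ i → IsCoprime ((m : ℤ) * p₀ - 1) ((hTuple k x j : ℤ) - hTuple k x i)) (c : ℕ) :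
    ∀ t ∈ (Finset.univ : Finset (Option (Fin k ⊕ Fin k))), ∀ q : ℕ,
      (sysDP p d d' e e' t : ℤ) ∣ sysPP c k m p₀ t + sysAP k x i m t * q →
        IsCoprime (sysAP k x i m t) (sysDP p d d' e e' t : ℤ) := by
  rintro (_ | t) - q hq
  · exact isCoprime_one_left
  · exact sys_unit hp₀ hd0 hd0' hdlt hei hei' hacop t (Finset.mem_univ t) q hq

/-- No prime of an extended modulus divides its constant term (`p ∤ c` for `c ∈ unitsR p`).
[cite: Maynard2016LargeGaps, Lemma 7 (proof, p. 12)] -/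
theorem sysP_constant_coprime {p c : ℕ} (hp : p.Prime) (hc : c ∈ unitsR p) {m p₀ : ℕ}
    (hp₀ : p₀.Prime) (hm : 1 ≤ m) {x : ℕ} {i : Fin k} {d d' e e' : Fin k → ℕ} (hd0 : ∀ j, d j ≠ 0)
    (hd0' : ∀ j, d' j ≠ 0) (hdlt : ∀ j, d j * d' j < p₀)
    (hecop : ∀ j, Nat.Coprime (m * p₀ - 1) (e j * e' j)) :
    ∀ t ∈ (Finset.univ : Finset (Option (Fin k ⊕ Fin k))), ∀ ℓ : ℕ, ℓ.Prime →
      ℓ ∣ sysDP p d d' e e' t → ¬ (ℓ : ℤ) ∣ sysPP c k m p₀ t := by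
  rintro (_ | t) - ℓ hℓ hℓD hℓP
  · simp only [sysDP_none, sysPP_none] at hℓD hℓP
    have hℓp : ℓ = p := (Nat.prime_dvd_prime_iff_eq hℓ hp).1 hℓD
    rw [hℓp, Int.dvd_neg, Int.natCast_dvd_natCast] at hℓP
    obtain ⟨hcp, hcop⟩ := mem_unitsR.1 hc
    have hc0 : c ≠ 0 := by
      rintro rfl
      exact hp.one_lt.ne' ((Nat.coprime_zero_right p).1 hcop)
    exact absurd (Nat.le_of_dvd (Nat.pos_of_ne_zero hc0) hℓP) (not_le.2 hcp)
  · have _ := x; have _ := i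
    exact sys_constant_coprime hp₀ hm hd0 hd0' hdlt hecop t (Finset.mem_univ t) ℓ hℓ hℓD hℓP

/-! ### Per tuple: one class or nothing -/

/-- **Per-tuple count in a class** ((6.28)–(6.29) with `q ≡ c (mod p)`): under the hypotheses of
`abs_card_filter_system_sub_mainCoeff_le`, for a prime `p` and `c ∈ unitsR p`:
`|#{q ∈ 𝓘 : q ≡ c (p) ∧ (6.27)} − mainCoeffP(#𝓘)| ≤ 2 E*(X; r_p)`.
[cite: Maynard2016LargeGaps, Lemma 7 (proof, displays (6.28)–(6.29) and before (6.33))] -/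
theorem abs_card_filter_class_system_sub_mainCoeffP_le {p c : ℕ} (hp : p.Prime) (hc : c ∈ unitsR p)
    {x m p₀ : ℕ} (hp₀ : p₀.Prime) (hm : 1 ≤ m)
    {i : Fin k} {d d' e e' : Fin k → ℕ} (hd : ∀ j, Squarefree (d j))
    (hd' : ∀ j, Squarefree (d' j)) (he : ∀ j, Squarefree (e j)) (he' : ∀ j, Squarefree (e' j))
    (hdlt : ∀ j, d j * d' j < p₀) (hecop : ∀ j, Nat.Coprime (m * p₀ - 1) (e j * e' j))
    (hei : e i = 1) (hei' : e' i = 1)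
    (hacop : ∀ j, j ≠ i → IsCoprime ((m : ℤ) * p₀ - 1) ((hTuple k x j : ℤ) - hTuple k x i))
    {A B : ℝ} {X : ℕ} (hA : 1 ≤ A) (hAB : A ≤ B) (hBX : B ≤ X)
    (hQ : ∀ q ∈ intervalPrimes A B, hTuple k x i * q < p₀) :
    |(((((intervalPrimes A B).filter (fun q => q % p = c)).filter
        (fun q => ∀ j ∈ (Finset.univ : Finset (Fin k)),
          Nat.lcm (d j) (d' j) ∣ p₀ - hTuple k x i * q + hTuple k x j * q ∧
            Nat.lcm (e j) (e' j) ∣ m * (p₀ - hTuple k x i * q + hTuple k x j * q) - 1)).card : ℕ) : ℝ) -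
        mainCoeffP p c k x m p₀ i d d' e e' ((intervalPrimes A B).card : ℝ)| ≤
      2 * primeCountingAPErrMax X (radP p d d' e e') := by
  classical
  have hcp : c < p := (mem_unitsR.1 hc).1
  have hd0 : ∀ j, d j ≠ 0 := fun j => (hd j).ne_zero
  have hd0' : ∀ j, d' j ≠ 0 := fun j => (hd' j).ne_zero
  -- the doubly filtered set is cut out by the extended system
  have hfil0 : ((intervalPrimes A B).filter (fun q => q % p = c)).filter
      (fun q => ∀ j ∈ (Finset.univ : Finset (Fin k)),
        Nat.lcm (d j) (d' j) ∣ p₀ - hTuple k x i * q + hTuple k x j * q ∧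
          Nat.lcm (e j) (e' j) ∣ m * (p₀ - hTuple k x i * q + hTuple k x j * q) - 1) =
      (intervalPrimes A B).filter (fun q : ℕ => ∀ t ∈ (Finset.univ : Finset (Option (Fin k ⊕ Fin k))),
        (sysDP p d d' e e' t : ℤ) ∣ sysPP c k m p₀ t + sysAP k x i m t * (q : ℤ)) := by
    rw [Finset.filter_filter]
    refine Finset.filter_congr fun q hq => ?_
    rw [classSystem_iff hcp, system_iff_linearSystem hm d d' e e' (hQ q hq)]
  rw [hfil0]
  rcases linearSystem_empty_or_coprime_class (Finset.univ : Finset (Option (Fin k ⊕ Fin k)))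
      (sysDP p d d' e e') (sysPP c k m p₀) (sysAP k x i m) (sysP_squarefree hp hd hd' he he')
      (sysP_unit hp₀ hd0 hd0' hdlt hei hei' hacop c)
      (sysP_constant_coprime hp hc hp₀ hm (x := x) (i := i) hd0 hd0' hdlt hecop)
    with hnone | ⟨c', hc', hcop', hiff⟩
  · -- no solution: both vanish
    have hsol : ¬ SysSolvableP p c k x m p₀ i d d' e e' := by
      rintro ⟨q, hq⟩
      exact hnone q ((classSystem_iff hcp d d' e e' q).2 hq)
    have hfil : (intervalPrimes A B).filter
        (fun q : ℕ => ∀ t ∈ (Finset.univ : Finset (Option (Fin k ⊕ Fin k))),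
          (sysDP p d d' e e' t : ℤ) ∣ sysPP c k m p₀ t + sysAP k x i m t * (q : ℤ)) = ∅ :=
      Finset.filter_eq_empty_iff.2 fun q _ h => hnone q h
    rw [hfil, mainCoeffP, if_neg hsol]
    simpa using primeCountingAPErrMax_nonneg X (radP p d d' e e')
  · -- one class `c' (mod r_p)` coprime to `r_p`
    rw [rad_sysDP_eq] at hc' hcop' hiff
    have hsol : SysSolvableP p c k x m p₀ i d d' e e' :=
      ⟨c', (classSystem_iff hcp d d' e e' c').1 ((hiff c').2 (Nat.mod_eq_of_lt hc'))⟩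
    have hfil : (intervalPrimes A B).filter
        (fun q : ℕ => ∀ t ∈ (Finset.univ : Finset (Option (Fin k ⊕ Fin k))),
          (sysDP p d d' e e' t : ℤ) ∣ sysPP c k m p₀ t + sysAP k x i m t * (q : ℤ)) =
        (intervalPrimes A B).filter (fun q => q % radP p d d' e e' = c' % radP p d d' e e') := by
      refine Finset.filter_congr fun q _ => ?_
      rw [hiff q, Nat.mod_eq_of_lt hc']
    rw [hfil, mainCoeffP, if_pos hsol]
    exact abs_card_intervalPrimes_filter_sub_le hA hAB hBX (radP_pos p d d' e e') hcop'

/-! ### Summed over the tuples -/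

/-- **Main/error split of the class-restricted `q`-sum**:
`|Σ_{q ∈ 𝓘, q ≡ c (p)} (Σ_{d,e} λ_{d,e})²|_{n = p₀ − h_i q} − Σ_{d,d',e,e' ∈ rbox} λλ' · mainCoeffP(#𝓘)|
 ≤ Σ_{d,d',e,e' ∈ rbox} |λλ'| · 2 E*(X; r_p)`, under the hypotheses of
`abs_sum_divSum_sq_sub_main_le`, for a prime `p` and `c ∈ unitsR p`.
[cite: Maynard2016LargeGaps, Lemma 7 (proof, displays (6.27)–(6.29) and before (6.33))] -/
theorem abs_sum_filter_divSum_sq_sub_main_le {J : ℕ} {c₀ : Fin J → ℝ}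
    {Fd : Fin k → Fin J → ℝ → ℝ} {G : ℝ → ℝ} (hD : IsSieveData k J c₀ Fd G) {ε : ℝ} {x : ℕ}
    (hx1 : 1 ≤ x) (hlogx : 0 < Real.log x) (hlogy : 0 < Real.log (y ε x)) (hyx : y ε x ≤ x)
    {m p₀ : ℕ} (hm : 1 ≤ m) (hp₀ : p₀.Prime) (hxp : x < p₀)
    (hcop : Nat.Coprime (m * p₀ - 1) (primorial ⌊y ε x⌋₊)) {i : Fin k}
    (hacop : ∀ j, j ≠ i → IsCoprime ((m : ℤ) * p₀ - 1) ((hTuple k x j : ℤ) - hTuple k x i))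
    {p c : ℕ} (hp : p.Prime) (hc : c ∈ unitsR p)
    {A B : ℝ} {X : ℕ} (hA : 1 ≤ A) (hAB : A ≤ B) (hBX : B ≤ X)
    (hQ : ∀ q ∈ intervalPrimes A B, hTuple k x i * q < p₀) :
    |∑ q ∈ (intervalPrimes A B).filter (fun q => q % p = c),
          divSum c₀ Fd G ε x m q (p₀ - hTuple k x i * q) ^ 2 -
        ∑ d ∈ rbox k x i, ∑ d' ∈ rbox k x i, ∑ e ∈ rbox k x i, ∑ e' ∈ rbox k x i,
          lam c₀ Fd G ε x d e * lam c₀ Fd G ε x d' e' *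
            mainCoeffP p c k x m p₀ i d d' e e' ((intervalPrimes A B).card : ℝ)| ≤
      ∑ d ∈ rbox k x i, ∑ d' ∈ rbox k x i, ∑ e ∈ rbox k x i, ∑ e' ∈ rbox k x i,
        |lam c₀ Fd G ε x d e * lam c₀ Fd G ε x d' e'| *
          (2 * primeCountingAPErrMax X (radP p d d' e e')) := by
  classical
  have hB0 : (0 : ℝ) ≤ B := by linarith
  have hQ' : ∀ q ∈ (intervalPrimes A B).filter (fun q => q % p = c),
      0 < q ∧ hTuple k x i * q < p₀ := fun q hq =>
    ⟨((mem_intervalPrimes hB0).1 (Finset.mem_filter.1 hq).1).1.pos, hQ q (Finset.mem_filter.1 hq).1⟩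
  rw [sum_divSum_sub_sq_eq_sum_rbox hD hx1 hlogx hlogy hyx hm hp₀ hxp hcop _ hQ']
  simp only [← Finset.sum_sub_distrib, ← mul_sub]
  refine (Finset.abs_sum_le_sum_abs _ _).trans (Finset.sum_le_sum fun d hd => ?_)
  refine (Finset.abs_sum_le_sum_abs _ _).trans (Finset.sum_le_sum fun d' hd' => ?_)
  refine (Finset.abs_sum_le_sum_abs _ _).trans (Finset.sum_le_sum fun e he => ?_)
  refine (Finset.abs_sum_le_sum_abs _ _).trans (Finset.sum_le_sum fun e' he' => ?_)
  rw [abs_mul]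
  by_cases hl : lam c₀ Fd G ε x d e = 0
  · simp [hl]
  by_cases hl' : lam c₀ Fd G ε x d' e' = 0
  · simp [hl']
  refine mul_le_mul_of_nonneg_left ?_ (abs_nonneg _)
  obtain ⟨hdb, -⟩ := mem_rbox.1 hd
  obtain ⟨hdb', -⟩ := mem_rbox.1 hd'
  obtain ⟨heb, hei⟩ := mem_rbox.1 he
  obtain ⟨heb', hei'⟩ := mem_rbox.1 he'
  obtain ⟨hsd, hsd', hse, hse', hdlt, hecop⟩ :=
    support_hyps_of_lam_ne_zero hD hx1 hlogx hlogy hxp hcop hdb hdb' heb heb' hl hl'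
  exact abs_card_filter_class_system_sub_mainCoeffP_le hp hc hp₀ hm hsd hsd' hse hse' hdlt hecop
    hei hei' hacop hA hAB hBX hQ

/-! ### The main term as a restricted second moment of the probability model -/

open Classical in
/-- **Per tuple**: `Λ_{d,e} Λ'_{d',e'} mainCoeffP(1) · φ(R) = Σ_{u ∈ U_R, u ≡ c (p)} Λ[SysT(d,e) u] Λ'[SysT(d',e') u]`
for admissible weights, `R` squarefree with `p ∣ R` and every squarefree `n ≤ x` dividing `R`.
[cite: Maynard2016LargeGaps, Lemma 7 (proof, displays (6.28)–(6.29) and before (6.33))] -/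
theorem mul_mainCoeffP_mul_totient_eq_sum_unitsR {p c : ℕ} (hp : p.Prime) (hc : c ∈ unitsR p)
    {x m p₀ : ℕ} (hp₀ : p₀.Prime) (hm : 1 ≤ m) {i : Fin k}
    (hacop : ∀ j, j ≠ i → IsCoprime ((m : ℤ) * p₀ - 1) ((hTuple k x j : ℤ) - hTuple k x i))
    {Λ Λ' : (Fin k → ℕ) → (Fin k → ℕ) → ℝ} (hΛ : AdmWt k m p₀ Λ) (hΛ' : AdmWt k m p₀ Λ')
    {R : ℕ} (hR : Squarefree R) (hpR : p ∣ R) (hxR : ∀ n, Squarefree n → n ≤ x → n ∣ R)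
    {d d' e e' : Fin k → ℕ} (hd : d ∈ rbox k x i) (hd' : d' ∈ rbox k x i) (he : e ∈ rbox k x i)
    (he' : e' ∈ rbox k x i) :
    Λ d e * Λ' d' e' * mainCoeffP p c k x m p₀ i d d' e e' 1 * (Nat.totient R : ℝ) =
      ∑ u ∈ (unitsR R).filter (fun u => u % p = c), (if SysT k x m p₀ i d e u then Λ d e else 0) *
        (if SysT k x m p₀ i d' e' u then Λ' d' e' else 0) := by
  have hcp : c < p := (mem_unitsR.1 hc).1
  -- the right-hand side is `ΛΛ' · #{u : extended system}`
  have hrhs : ∑ u ∈ (unitsR R).filter (fun u => u % p = c),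
        (if SysT k x m p₀ i d e u then Λ d e else 0) *
          (if SysT k x m p₀ i d' e' u then Λ' d' e' else 0) =
      Λ d e * Λ' d' e' * (((unitsR R).filter (fun u : ℕ =>
        ∀ t ∈ (Finset.univ : Finset (Option (Fin k ⊕ Fin k))),
          (sysDP p d d' e e' t : ℤ) ∣ sysPP c k m p₀ t + sysAP k x i m t * (u : ℤ))).card : ℝ) := by
    have hfil : (unitsR R).filter (fun u : ℕ =>
        ∀ t ∈ (Finset.univ : Finset (Option (Fin k ⊕ Fin k))),
          (sysDP p d d' e e' t : ℤ) ∣ sysPP c k m p₀ t + sysAP k x i m t * (u : ℤ)) =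
        ((unitsR R).filter (fun u => u % p = c)).filter
          (fun u => SysT k x m p₀ i d e u ∧ SysT k x m p₀ i d' e' u) := by
      rw [Finset.filter_filter]
      refine Finset.filter_congr fun u _ => ?_
      rw [classSystem_iff hcp, linearSystem_iff_sysT_and]
    rw [hfil]
    have : ∀ u, (if SysT k x m p₀ i d e u then Λ d e else 0) *
        (if SysT k x m p₀ i d' e' u then Λ' d' e' else 0) =
        if SysT k x m p₀ i d e u ∧ SysT k x m p₀ i d' e' u then Λ d e * Λ' d' e' else 0 := by
      intro u
      split_ifs <;> simp_all
    simp_rw [this]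
    rw [Finset.sum_ite, Finset.sum_const_zero, add_zero, Finset.sum_const, nsmul_eq_mul, mul_comm]
  rw [hrhs]
  by_cases hz : Λ d e = 0
  · simp [hz]
  by_cases hz' : Λ' d' e' = 0
  · simp [hz']
  obtain ⟨hsd, hsd', hse, hse', hdlt, hecop⟩ := hΛ.pair_hyps hΛ' hz hz'
  have hei : e i = 1 := (mem_rbox.1 he).2
  have hei' : e' i = 1 := (mem_rbox.1 he').2
  have hd0 : ∀ j, d j ≠ 0 := fun j => (hsd j).ne_zero
  have hd0' : ∀ j, d' j ≠ 0 := fun j => (hsd' j).ne_zero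
  have hcoord : ∀ {f : Fin k → ℕ}, f ∈ rbox k x i → (∀ j, Squarefree (f j)) → ∀ j, f j ∣ R := by
    intro f hf hsq j
    have hfb := (mem_rbox.1 hf).1
    have hle : f j ≤ x := (Finset.mem_Icc.1 (Fintype.mem_piFinset.1 hfb j)).2
    exact hxR _ (hsq j) hle
  have hDR : ∀ t ∈ (Finset.univ : Finset (Option (Fin k ⊕ Fin k))), sysDP p d d' e e' t ∣ R := by
    rintro (_ | (j | j)) -
    · exact hpR
    · exact Nat.lcm_dvd (hcoord hd hsd j) (hcoord hd' hsd' j)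
    · exact Nat.lcm_dvd (hcoord he hse j) (hcoord he' hse' j)
  have key := card_unitsR_filter_linearSystem_mul (Finset.univ : Finset (Option (Fin k ⊕ Fin k)))
    (sysDP p d d' e e') (sysPP c k m p₀) (sysAP k x i m) (sysP_squarefree hp hsd hsd' hse hse')
    (sysP_unit hp₀ hd0 hd0' hdlt hei hei' hacop c)
    (sysP_constant_coprime hp hc hp₀ hm (x := x) (i := i) hd0 hd0' hdlt hecop) hR hDR
  rw [rad_sysDP_eq] at key
  have hrad0 : (0 : ℝ) < (Nat.totient (radP p d d' e e') : ℝ) := by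
    exact_mod_cast Nat.totient_pos.2 (radP_pos p d d' e e')
  have hiffsol : (∃ u : ℕ, ∀ t ∈ (Finset.univ : Finset (Option (Fin k ⊕ Fin k))),
      (sysDP p d d' e e' t : ℤ) ∣ sysPP c k m p₀ t + sysAP k x i m t * (u : ℤ)) ↔
      SysSolvableP p c k x m p₀ i d d' e e' := by
    simp only [SysSolvableP, classSystem_iff hcp]
  have key' : ((((unitsR R).filter (fun u : ℕ =>
        ∀ t ∈ (Finset.univ : Finset (Option (Fin k ⊕ Fin k))),
          (sysDP p d d' e e' t : ℤ) ∣ sysPP c k m p₀ t + sysAP k x i m t * (u : ℤ))).card : ℕ) : ℝ) *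
        (Nat.totient (radP p d d' e e') : ℝ) =
      if SysSolvableP p c k x m p₀ i d d' e e' then (Nat.totient R : ℝ) else 0 := by
    convert key using 5
    exact hiffsol.symm
  unfold mainCoeffP
  by_cases hsol : SysSolvableP p c k x m p₀ i d d' e e'
  · rw [if_pos hsol]
    rw [if_pos hsol] at key'
    have hcard : ((((unitsR R).filter (fun u : ℕ =>
        ∀ t ∈ (Finset.univ : Finset (Option (Fin k ⊕ Fin k))),
          (sysDP p d d' e e' t : ℤ) ∣ sysPP c k m p₀ t + sysAP k x i m t * (u : ℤ))).card : ℕ) : ℝ) =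
        (Nat.totient R : ℝ) / (Nat.totient (radP p d d' e e') : ℝ) := by
      rw [eq_div_iff hrad0.ne', key']
    rw [hcard]
    ring
  · rw [if_neg hsol]
    rw [if_neg hsol] at key'
    have hcard : ((((unitsR R).filter (fun u : ℕ =>
        ∀ t ∈ (Finset.univ : Finset (Option (Fin k ⊕ Fin k))),
          (sysDP p d d' e e' t : ℤ) ∣ sysPP c k m p₀ t + sysAP k x i m t * (u : ℤ))).card : ℕ) : ℝ) =
        0 := by
      rcases mul_eq_zero.1 key' with h | h
      · exact h
      · exact absurd h hrad0.ne'
    rw [hcard]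
    ring

/-- The class quadratic form `Q_p(Λ, Λ') = Σ_{d,d',e,e' ∈ rbox} Λ_{d,e} Λ'_{d',e'} mainCoeffP(1)`.
[cite: Maynard2016LargeGaps, Lemma 7 (proof, display (6.29) and before (6.33))] -/
def QformP (p c : ℕ) (k x m p₀ : ℕ) (i : Fin k) (Λ Λ' : (Fin k → ℕ) → (Fin k → ℕ) → ℝ) : ℝ :=
  ∑ d ∈ rbox k x i, ∑ d' ∈ rbox k x i, ∑ e ∈ rbox k x i, ∑ e' ∈ rbox k x i,
    Λ d e * Λ' d' e' * mainCoeffP p c k x m p₀ i d d' e e' 1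

/-- `Q_p` only sees the weights on `rbox²`. [cite: Maynard2016LargeGaps, Lemma 7 (proof, display (6.29))] -/
theorem QformP_restrict (p c k x m p₀ : ℕ) (i : Fin k) (Λ Λ' : (Fin k → ℕ) → (Fin k → ℕ) → ℝ) :
    QformP p c k x m p₀ i (fun d e => if d ∈ rbox k x i ∧ e ∈ rbox k x i then Λ d e else 0)
        (fun d e => if d ∈ rbox k x i ∧ e ∈ rbox k x i then Λ' d e else 0) =
      QformP p c k x m p₀ i Λ Λ' := by
  unfold QformP
  refine Finset.sum_congr rfl fun d hd => Finset.sum_congr rfl fun d' hd' =>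
    Finset.sum_congr rfl fun e he => Finset.sum_congr rfl fun e' he' => ?_
  simp only [hd, he, hd', he', and_self, if_true]

/-- The main term of the class split with `N = #𝓘` is `N · Q_p(λ, λ)`.
[cite: Maynard2016LargeGaps, Lemma 7 (proof, display (6.29) and before (6.33))] -/
theorem sum_mainCoeffP_eq (p c : ℕ) {J : ℕ} (c₀ : Fin J → ℝ) (Fd : Fin k → Fin J → ℝ → ℝ)
    (G : ℝ → ℝ) (ε : ℝ) (x m p₀ : ℕ) (i : Fin k) (N : ℝ) :
    ∑ d ∈ rbox k x i, ∑ d' ∈ rbox k x i, ∑ e ∈ rbox k x i, ∑ e' ∈ rbox k x i,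
        lam c₀ Fd G ε x d e * lam c₀ Fd G ε x d' e' * mainCoeffP p c k x m p₀ i d d' e e' N =
      N * QformP p c k x m p₀ i (lam c₀ Fd G ε x) (lam c₀ Fd G ε x) := by
  unfold QformP
  rw [Finset.mul_sum]
  refine Finset.sum_congr rfl fun d _ => ?_
  rw [Finset.mul_sum]
  refine Finset.sum_congr rfl fun d' _ => ?_
  rw [Finset.mul_sum]
  refine Finset.sum_congr rfl fun e _ => ?_
  rw [Finset.mul_sum]
  refine Finset.sum_congr rfl fun e' _ => ?_
  rw [mainCoeffP_eq_mul_one]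
  ring

open Classical in
/-- **The class main term is a restricted second moment**: for admissible `Λ, Λ'`, `R` squarefree,
`p ∣ R`, every squarefree `n ≤ x` dividing `R`:
`Q_p(Λ, Λ') · φ(R) = Σ_{u ∈ U_R, u ≡ c (p)} X_Λ(u) X_{Λ'}(u)`.
[cite: Maynard2016LargeGaps, Lemma 7 (proof, displays (6.29), (6.32) and before (6.33))] -/
theorem QformP_mul_totient_eq_sum_filter_unitsR {p c : ℕ} (hp : p.Prime) (hc : c ∈ unitsR p)
    {x m p₀ : ℕ} (hp₀ : p₀.Prime) (hm : 1 ≤ m) {i : Fin k}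
    (hacop : ∀ j, j ≠ i → IsCoprime ((m : ℤ) * p₀ - 1) ((hTuple k x j : ℤ) - hTuple k x i))
    {Λ Λ' : (Fin k → ℕ) → (Fin k → ℕ) → ℝ} (hΛ : AdmWt k m p₀ Λ) (hΛ' : AdmWt k m p₀ Λ')
    {R : ℕ} (hR : Squarefree R) (hpR : p ∣ R) (hxR : ∀ n, Squarefree n → n ≤ x → n ∣ R) :
    QformP p c k x m p₀ i Λ Λ' * (Nat.totient R : ℝ) =
      ∑ u ∈ (unitsR R).filter (fun u => u % p = c), Xwt k x m p₀ i Λ u * Xwt k x m p₀ i Λ' u := by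
  have hrhs : ∀ u, Xwt k x m p₀ i Λ u * Xwt k x m p₀ i Λ' u =
      ∑ d ∈ rbox k x i, ∑ d' ∈ rbox k x i, ∑ e ∈ rbox k x i, ∑ e' ∈ rbox k x i,
        (if SysT k x m p₀ i d e u then Λ d e else 0) *
          (if SysT k x m p₀ i d' e' u then Λ' d' e' else 0) := by
    intro u
    unfold Xwt
    rw [Finset.sum_mul_sum]
    refine Finset.sum_congr rfl fun d _ => Finset.sum_congr rfl fun d' _ => ?_
    rw [Finset.sum_mul_sum]
  simp only [hrhs]
  unfold QformP
  rw [Finset.sum_mul, Finset.sum_comm]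
  refine Finset.sum_congr rfl fun d hd => ?_
  rw [Finset.sum_mul, Finset.sum_comm]
  refine Finset.sum_congr rfl fun d' hd' => ?_
  rw [Finset.sum_mul, Finset.sum_comm]
  refine Finset.sum_congr rfl fun e he => ?_
  rw [Finset.sum_mul, Finset.sum_comm]
  refine Finset.sum_congr rfl fun e' he' => ?_
  exact mul_mainCoeffP_mul_totient_eq_sum_unitsR hp hc hp₀ hm hacop hΛ hΛ' hR hpR hxR hd hd' he he'

/-! ### The two bounds for the class main term -/

/-- `p · (P_x / p) = P_x` for a prime `p ≤ x`. [cite: Maynard2016LargeGaps, Lemma 7 (proof, before (6.33))] -/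
theorem mul_primorial_div_eq {p x : ℕ} (hp : p.Prime) (hpx : p ≤ x) :
    p * (primorial x / p) = primorial x :=
  Nat.mul_div_cancel' (dvd_primorial_of_squarefree_le hp.squarefree hpx)

/-- **Trivial bound**: `Q_p(Λ, Λ) ≤ Q(Λ, Λ)` (drop the condition `u ≡ c (p)` in the second moment).
[cite: Maynard2016LargeGaps, Lemma 7 (proof, before (6.33))] -/
theorem QformP_le_Qform {p c : ℕ} (hp : p.Prime) (hc : c ∈ unitsR p) {x m p₀ : ℕ} (hpx : p ≤ x)
    (hp₀ : p₀.Prime) (hm : 1 ≤ m) {i : Fin k}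
    (hacop : ∀ j, j ≠ i → IsCoprime ((m : ℤ) * p₀ - 1) ((hTuple k x j : ℤ) - hTuple k x i))
    {Λ : (Fin k → ℕ) → (Fin k → ℕ) → ℝ} (hΛ : AdmWt k m p₀ Λ) :
    QformP p c k x m p₀ i Λ Λ ≤ Qform k x m p₀ i Λ Λ := by
  have hR : Squarefree (primorial x) := squarefree_primorial x
  have hpR : p ∣ primorial x := dvd_primorial_of_squarefree_le hp.squarefree hpx
  have hxR : ∀ n, Squarefree n → n ≤ x → n ∣ primorial x := fun n hn hnx =>
    dvd_primorial_of_squarefree_le hn hnx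
  have hφ : (0 : ℝ) < (Nat.totient (primorial x) : ℝ) := by
    exact_mod_cast Nat.totient_pos.2 (primorial_pos x)
  have h1 := QformP_mul_totient_eq_sum_filter_unitsR hp hc hp₀ hm hacop hΛ hΛ hR hpR hxR (i := i)
  have h2 := Qform_mul_totient_eq_sum_unitsR hp₀ hm hacop hΛ hΛ hR hxR (i := i)
  have h3 : ∑ u ∈ (unitsR (primorial x)).filter (fun u => u % p = c),
      Xwt k x m p₀ i Λ u * Xwt k x m p₀ i Λ u ≤
      ∑ u ∈ unitsR (primorial x), Xwt k x m p₀ i Λ u * Xwt k x m p₀ i Λ u :=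
    Finset.sum_le_sum_of_subset_of_nonneg (Finset.filter_subset _ _) fun u _ _ =>
      mul_self_nonneg _
  rw [← h1, ← h2] at h3
  exact le_of_mul_le_mul_right h3 hφ

/-- **The class bound for the main term**: for a prime `p ≤ x` with `4(k−1) ≤ p − 1`, `p ∤ m`,
`p ∤ h_j − h_i` (`j ≠ i`), `c ∈ unitsR p`, admissible `Λ` and admissible extensions `W_{S,T}` of the
`p`-free pattern weights of `Λ` on `rbox²`:
`Q_p(Λ, Λ) ≤ (2·4^k/(p−1)) Σ_{S,T} Q(W_{S,T}, W_{S,T})`.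
[cite: Maynard2016LargeGaps, Lemma 7 (proof, before (6.33))] -/
theorem QformP_le_sum_Qform_of_pfPart {p c : ℕ} (hp : p.Prime) (hc : c ∈ unitsR p) {x m p₀ : ℕ}
    (hpx : p ≤ x) (hp₀ : p₀.Prime) (hm : 1 ≤ m) {i : Fin k}
    (hacop : ∀ j, j ≠ i → IsCoprime ((m : ℤ) * p₀ - 1) ((hTuple k x j : ℤ) - hTuple k x i))
    {Λ : (Fin k → ℕ) → (Fin k → ℕ) → ℝ} (hΛ : AdmWt k m p₀ Λ) (hpk : 4 * (k - 1) ≤ p - 1)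
    (hpm : ¬ p ∣ m) (hph : ∀ j, j ≠ i → ¬ (p : ℤ) ∣ (hTuple k x j : ℤ) - hTuple k x i)
    (W : Finset (Fin k) → Finset (Fin k) → (Fin k → ℕ) → (Fin k → ℕ) → ℝ)
    (hWadm : ∀ S T, AdmWt k m p₀ (W S T))
    (hW : ∀ S T, ∀ d ∈ rbox k x i, ∀ e ∈ rbox k x i,
      pfPart p (W S T) d e = patWt k x i p S T Λ d e) :
    QformP p c k x m p₀ i Λ Λ ≤
      (2 * (4 : ℝ) ^ k / (p - 1 : ℝ)) *
        ∑ S ∈ (Finset.univ : Finset (Fin k)).powerset, ∑ T ∈ (Finset.univ : Finset (Fin k)).powerset,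
          Qform k x m p₀ i (W S T) (W S T) := by
  have hPR : p * (primorial x / p) = primorial x := mul_primorial_div_eq hp hpx
  have hR : Squarefree (p * (primorial x / p)) := by rw [hPR]; exact squarefree_primorial x
  have hxR : ∀ n, Squarefree n → n ≤ x → n ∣ p * (primorial x / p) := fun n hn hnx => by
    rw [hPR]; exact dvd_primorial_of_squarefree_le hn hnx
  have hpR : p ∣ p * (primorial x / p) := dvd_mul_right p _
  have hφ : (0 : ℝ) < (Nat.totient (p * (primorial x / p)) : ℝ) := by
    rw [hPR]; exact_mod_cast Nat.totient_pos.2 (primorial_pos x)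
  have h1 := QformP_mul_totient_eq_sum_filter_unitsR hp hc hp₀ hm hacop hΛ hΛ hR hpR hxR (i := i)
  have h2 := sum_filter_mod_Xwt_sq_le_totient_mul_Qform_of_pfPart hp₀ hm hacop hΛ hp hpk hpm hph hR
    hxR hc W hWadm hW
  simp only [sq] at h2
  rw [← h1, mul_assoc, mul_comm (Nat.totient (p * (primorial x / p)) : ℝ), ← mul_assoc] at h2
  exact le_of_mul_le_mul_right h2 hφ

end Maynard2016

end Literature.NumberTheory.Sieve

end
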